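import Mathlib
import Summits.MatrixMultiplication.MatrixMultiplication.Theorems.FidelityWitnessesFidelityThesisSepMajorantSingleProduct

/-!
# Line `separable-majorant` for crux `FidelityWitnesses.FidelityThesis` (stmt-MatrixMultiplication-4956) —
stub `stub_gramFrobenius`: Frobenius mass of the Gram-type matrix of orthonormal rows

For `d` coefficient rows `γ_s ∈ ℂ^{k×k'}` that are orthonormal (`Σ_q conj (γ_s q) γ_t q = δ_{st}`,
hypothesis `hγ`), the matrix `G_{q q'} := Σ_s γ_s(q) · conj γ_s(q')` (the matrix of the projector `P_E`
onto `E = span{e_s}` written in the orthonormal pair family) has Frobenius mass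
`Σ_{q,q'} |G_{q q'}|² = d` (`= tr P_E`).

Proof.  Work with the complex identity `conj z · z = ‖z‖²`:
`Σ_{q,q'} conj(G_{qq'}) G_{qq'} = Σ_t Σ_s (Σ_q conj (γ_t q) γ_s q) · (Σ_{q'} γ_t q' conj (γ_s q'))`
(expand, swap the finite sums, regroup) `= Σ_t Σ_s δ_{ts} δ_{ts} = d`, then cast back to `ℝ`.
Feeds `stub_capBound`.  Supports item `stmt-MatrixMultiplication-4956`; no definitions; imports toolkit I only.
-/

namespace Summit.MatrixMultiplication.MatrixMultiplication.Theorems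

open scoped BigOperators ComplexConjugate
open Literature.Computability.AlgebraicComplexity

/-- Moving a sum over the pair-family index `q : Fin k × Fin k'` inside a double sum over the basis
indices `t, s : Fin d`. [folklore] -/
theorem sepMajorantGF_sum_rotate {d k k' : ℕ} (Z : (Fin k × Fin k') → Fin d → Fin d → ℂ) :
    ∑ q, ∑ t, ∑ s, Z q t s = ∑ t, ∑ s, ∑ q, Z q t s := by
  calc ∑ q, ∑ t, ∑ s, Z q t s = ∑ t, ∑ q, ∑ s, Z q t s := Finset.sum_comm
    _ = ∑ t, ∑ s, ∑ q, Z q t s := Finset.sum_congr rfl fun t _ => Finset.sum_comm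

/-- The orthonormality relation of the rows `γ_s` read with the factors flipped:
`Σ_{q'} γ_t q' · conj (γ_s q') = δ_{ts}`. [folklore] -/
theorem sepMajorantGF_orthonormal_flip {d k k' : ℕ} (γ : Fin d → Fin k × Fin k' → ℂ)
    (hγ : ∀ s t : Fin d, (∑ q, conj (γ s q) * γ t q) = if s = t then 1 else 0) (t s : Fin d) :
    (∑ q', γ t q' * conj (γ s q')) = if t = s then 1 else 0 := by
  rw [show (∑ q', γ t q' * conj (γ s q')) = ∑ q', conj (γ s q') * γ t q' from
    Finset.sum_congr rfl fun q' _ => mul_comm _ _, hγ s t]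
  exact if_congr eq_comm rfl rfl

/-- The complex form of the Frobenius-mass identity: for orthonormal rows `γ_s`,
`Σ_{q,q'} conj(G_{qq'}) · G_{qq'} = d` with `G_{qq'} = Σ_s γ_s q · conj (γ_s q')`. [folklore] -/
theorem sepMajorantGF_gram_conj_mul_sum {d k k' : ℕ} (γ : Fin d → Fin k × Fin k' → ℂ)
    (hγ : ∀ s t : Fin d, (∑ q, conj (γ s q) * γ t q) = if s = t then 1 else 0) :
    (∑ q, ∑ q', conj (∑ s, γ s q * conj (γ s q')) * ∑ s, γ s q * conj (γ s q')) = (d : ℂ) := by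
  -- the conjugate of an entry of `G`
  have hconj : ∀ q q' : Fin k × Fin k',
      conj (∑ s, γ s q * conj (γ s q')) = ∑ t, conj (γ t q) * γ t q' := by
    intro q q'
    rw [map_sum]
    exact Finset.sum_congr rfl fun t _ => by rw [map_mul, Complex.conj_conj]
  calc (∑ q, ∑ q', conj (∑ s, γ s q * conj (γ s q')) * ∑ s, γ s q * conj (γ s q'))
      = ∑ q, ∑ q', ∑ t, ∑ s, (conj (γ t q) * γ s q) * (γ t q' * conj (γ s q')) := by
        refine Finset.sum_congr rfl fun q _ => Finset.sum_congr rfl fun q' _ => ?_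
        rw [hconj q q', Finset.sum_mul_sum]
        exact Finset.sum_congr rfl fun t _ => Finset.sum_congr rfl fun s _ => by ring
    _ = ∑ q, ∑ t, ∑ s, ∑ q', (conj (γ t q) * γ s q) * (γ t q' * conj (γ s q')) :=
        Finset.sum_congr rfl fun q _ =>
          sepMajorantGF_sum_rotate fun q' t s => (conj (γ t q) * γ s q) * (γ t q' * conj (γ s q'))
    _ = ∑ t, ∑ s, ∑ q, ∑ q', (conj (γ t q) * γ s q) * (γ t q' * conj (γ s q')) :=
        sepMajorantGF_sum_rotate fun q t s => ∑ q', (conj (γ t q) * γ s q) * (γ t q' * conj (γ s q'))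
    _ = ∑ t, ∑ s, (∑ q, conj (γ t q) * γ s q) * ∑ q', γ t q' * conj (γ s q') := by
        refine Finset.sum_congr rfl fun t _ => Finset.sum_congr rfl fun s _ => ?_
        rw [Finset.sum_mul_sum]
    _ = ∑ t, ∑ s, if t = s then (1 : ℂ) else 0 := by
        refine Finset.sum_congr rfl fun t _ => Finset.sum_congr rfl fun s _ => ?_
        rw [hγ t s, sepMajorantGF_orthonormal_flip γ hγ t s]
        by_cases hts : t = s
        · simp [hts]
        · simp [hts]
    _ = ∑ _t : Fin d, (1 : ℂ) := Finset.sum_congr rfl fun t _ => by simp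
    _ = (d : ℂ) := by simp

/-- **Stub `stub_gramFrobenius`** (line `separable-majorant`, crux `FidelityWitnesses.FidelityThesis`).
For `d` orthonormal coefficient rows `γ_s ∈ ℂ^{k×k'}` (`Σ_q conj (γ_s q) γ_t q = δ_{st}`), the Gram-type
matrix `G_{q q'} = Σ_s γ_s(q) · conj γ_s(q')` — the matrix of the projector onto `span{γ_s}` in the pair
family — has Frobenius mass `Σ_{q,q'} |G_{qq'}|² = d`. [folklore] -/
theorem stub_gramFrobenius {d k k' : ℕ} (γ : Fin d → Fin k × Fin k' → ℂ)
    (hγ : ∀ s t : Fin d, (∑ q, conj (γ s q) * γ t q) = if s = t then 1 else 0) :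
    ∑ q, ∑ q', ‖∑ s, γ s q * conj (γ s q')‖ ^ 2 = (d : ℝ) := by
  have hC := sepMajorantGF_gram_conj_mul_sum γ hγ
  simp_rw [Complex.conj_mul'] at hC
  exact_mod_cast hC

end Summit.MatrixMultiplication.MatrixMultiplication.Theorems
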